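import Summits.QuantumAdvantage.QuantumAdvantage.Theorems.CubicForrelationNearExactIsExactTwelveWindowHyperplane
import Summits.QuantumAdvantage.QuantumAdvantage.Theorems.CubicForrelationNearExactIsExactElevenDigits
import Summits.QuantumAdvantage.QuantumAdvantage.Theorems.CubicForrelationNearExactIsExactMmFormCeilingA

/-!
# Crux `CubicForrelation.NearExactIsExact` (stmt-QuantumAdvantage-14043) — n = 12 window `(59/64, 1)`: the digit on the odd
  hyperplane is QUADRATIC

Certificate seat `b2b-cforr-cert` (gen 14).  HONEST FRAMING: lemmas (standard axioms) for the theorem `θ₁₂ ≤ 59/64`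
(`…TwelveWindow5964.lean`): finite-slice bookkeeping about cubic Boolean pairs on 12 bits, NOT summit progress.

Setting: cubic `g` on 12 bits with `W_g = 32·u'`, odd set `P_g = {u' odd} = {(−1)^{γ·x} = t}` (an affine hyperplane, normal `γ` with a
coordinate `γ_i = 1`), and the pair exact off `P_g`: `u' = 2(−1)^f` there.  The tree knew that the digit `[⌊u'/2⌋ odd]` is CUBIC on
`𝔽₂¹²` (`tw5_digit`).  Here it is shown to be QUADRATIC on the hyperplane:
* `tw59_W_split`: `W_g(x) = W_{g₀}(π_i x) + (−1)^{x_i} W_{g₁}(π_i x)` for the restrictions `g_b = g|_{y_i = b}` (cubics on 11 bits,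
  `tw59_restrict_isDegLeFun`) and the coordinate projection `π_i`;
* `tw59_half_spectrum`: for `x ∈ P_g` (so `x ⊕ e_i ∉ P_g`), adding the two split identities gives `u'(x) = w₀(π_i x) − 2(−1)^{f(x ⊕ e_i)}`
  with `W_{g₀} = 16·w₀`; hence the residual `e_g = u' − 2(−1)^f` is `≡ w₀(π_i x) (mod 4)` on `P_g`;
* `tw59_quadratic_digit`: with `D̄ := [⌊w₀/2⌋ odd] ∘ π_i`, which has degree `≤ 2` by the 11-bit digit lemma `el_digitOne`,
  `e_g ≡ (−1)^{D̄} (mod 4)` on `P_g`.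
So the sign pattern `σ = (−1)^{D̄}` of the residual on the odd hyperplane is the sign function of a QUADRATIC — the input that makes
the relative-bentness argument of `…TwelveWindowPairing.lean` work.

References: Ax (1964) / McEliece (1972); C. Carlet, *Boolean Functions for Cryptography and Coding Theory* (CUP 2021) §2.2–2.3.
Everything below is proved from Mathlib and the tree.
-/

set_option linter.dupNamespace false -- D-0017: single-problem summit ⇒ `QuantumAdvantage.QuantumAdvantage` by design

noncomputable section

namespace Summit.QuantumAdvantage.QuantumAdvantage.Theorems.CubicForrelation.NearExactIsExact

open Finset
open Literature.Computability.QuantumComplexity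
open Literature.Computability.QuantumComplexity.BuzetChailloux (bxor zeroVec bxor_bxor_cancel_left bxor_zeroVec zeroVec_bxor bxor_comm
  bxor_self twist_zeroVec_right twist_bxor_right signOf_sq)
open Literature.Computability.QuantumComplexity.Simon (twist_eq_one_or)
open Literature.Computability.QuantumComplexity.DerivativeWalsh (W twist_bxor_left)

/-! ### Splitting the Walsh transform along one coordinate of the dual variable -/

/-- The twist splits along coordinate `i`: `(−1)^{(b, y')·x} = [b ∧ x_i](−1) · (−1)^{y'·π_i x}`. [folklore] -/
theorem tw59_twist_insertNth (i : Fin (6 + 6)) (b : Bool) (y' : Fin 11 → Bool) (x : Fin (6 + 6) → Bool) :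
    twist (Fin.insertNth i b y' : Fin (6 + 6) → Bool) x =
      (if b && x i then (-1 : ℝ) else 1) * twist y' (fun j => x (i.succAbove j)) := by
  unfold twist
  rw [Fin.prod_univ_succAbove _ i]
  simp only [Fin.insertNth_apply_same, Fin.insertNth_apply_succAbove]

/-- **Coordinate split of the Walsh transform**: `W_g(x) = W_{g₀}(π_i x) + (−1)^{x_i}·W_{g₁}(π_i x)`, where `g_b(y') = g(y' with y_i = b)`
and `π_i` deletes coordinate `i`. [folklore] -/
theorem tw59_W_split (g : (Fin (6 + 6) → Bool) → Bool) (i : Fin (6 + 6)) (x : Fin (6 + 6) → Bool) :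
    W (fun y => signOf (g y)) x =
      W (fun y' => signOf (g (Fin.insertNth i false y'))) (fun j => x (i.succAbove j)) +
        signOf (x i) * W (fun y' => signOf (g (Fin.insertNth i true y'))) (fun j => x (i.succAbove j)) := by
  unfold W
  rw [← (Fin.insertNthEquiv (fun _ => Bool) i).sum_comp, Fintype.sum_prod_type, Fintype.sum_bool]
  have e : ∀ (b : Bool) (y' : Fin 11 → Bool),
      (fun y => signOf (g y) * twist y x) ((Fin.insertNthEquiv (fun _ => Bool) i) (b, y')) =
        signOf (g (Fin.insertNth i b y')) * ((if b && x i then (-1 : ℝ) else 1) * twist y' (fun j => x (i.succAbove j))) := by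
    intro b y'
    change signOf (g (Fin.insertNth i b y')) * twist (Fin.insertNth i b y' : Fin (6 + 6) → Bool) x = _
    rw [tw59_twist_insertNth]
  simp only [e, Bool.true_and, Bool.false_and]
  rw [add_comm, mul_sum]
  congr 1
  · refine sum_congr rfl fun y' _ => ?_
    simp
  · refine sum_congr rfl fun y' _ => ?_
    unfold signOf
    split_ifs <;> ring

/-- The restriction `g|_{y_i = b}` of a cubic is cubic (composition with an affine embedding, `fc_isDegLeFun_comp`). [folklore] -/
theorem tw59_restrict_isDegLeFun (g : (Fin (6 + 6) → Bool) → Bool) (hg : IsDegLeFun 3 g) (i : Fin (6 + 6)) (b : Bool) :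
    IsDegLeFun 3 (fun y' : Fin 11 → Bool => g (Fin.insertNth i b y')) := by
  refine fc_isDegLeFun_comp (D := 1) hg (fun y' : Fin 11 → Bool => (Fin.insertNth i b y' : Fin (6 + 6) → Bool)) (fun v => ?_)
    (by norm_num)
  by_cases hv : v = i
  · subst hv
    simp only [Fin.insertNth_apply_same]
    exact isDegLeFun_const 1 b
  · obtain ⟨j, rfl⟩ := Fin.exists_succAbove_eq hv
    simp only [Fin.insertNth_apply_succAbove]
    exact isDegLeFun_apply j le_rfl

/-- The twist against the coordinate vector `e_i` is `(−1)^{γ_i}`. [folklore] -/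
theorem tw59_twist_single_right (γ : Fin (6 + 6) → Bool) (i : Fin (6 + 6)) :
    twist γ (fun j => decide (j = i)) = signOf (γ i) := by
  rw [twist_comm]; exact tb_twist_single i γ

/-! ### The half-spectrum identity on the odd hyperplane -/

/-- **Half-spectrum identity.**  If `W_g = 32u'`, the odd set is the hyperplane `{(−1)^{γ·x} = t}` with `γ_i = 1`, and `u' = 2(−1)^f`
off it, then for every `x` IN the odd set `u'(x) = w₀(π_i x) − 2(−1)^{f(x ⊕ e_i)}`, where `W_{g|_{y_i=0}} = 16·w₀`
(add the split identities at `x` and `x ⊕ e_i ∉ P_g`). [this work] -/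
theorem tw59_half_spectrum (f g : (Fin (6 + 6) → Bool) → Bool) (u' : (Fin (6 + 6) → Bool) → ℤ)
    (hu' : ∀ x, W (fun y => signOf (g y)) x = (2 : ℝ) ^ 5 * (u' x : ℝ))
    (γ : Fin (6 + 6) → Bool) (tg : ℝ) (hPg : ∀ x, (Odd (u' x) ↔ twist γ x = tg)) (i : Fin (6 + 6)) (hγi : γ i = true)
    (hoff : ∀ y, ¬ Odd (u' y) → u' y = 2 * sZ (f y)) (w₀ : (Fin 11 → Bool) → ℤ)
    (hw₀ : ∀ x', W (fun y' => signOf (g (Fin.insertNth i false y'))) x' = (2 : ℝ) ^ 4 * (w₀ x' : ℝ))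
    (x : Fin (6 + 6) → Bool) (hx : Odd (u' x)) :
    u' x = w₀ (fun j => x (i.succAbove j)) - 2 * sZ (f (bxor x (fun j => decide (j = i)))) := by
  set ei : Fin (6 + 6) → Bool := fun j => decide (j = i) with hei
  -- `x ⊕ e_i` is off the odd hyperplane
  have htx : twist γ x = tg := (hPg x).1 hx
  have hnot : ¬ Odd (u' (bxor x ei)) := by
    intro hodd
    have h2 := (hPg (bxor x ei)).1 hodd
    rw [twist_bxor_right, htx, tw59_twist_single_right, hγi] at h2
    have htg : tg = 1 ∨ tg = -1 := by rw [← htx]; exact twist_eq_one_or γ x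
    rcases htg with h | h <;> rw [h] at h2 <;> norm_num [signOf] at h2
  have hexact := hoff _ hnot
  -- the two split identities
  have hs1 := tw59_W_split g i x
  have hs2 := tw59_W_split g i (bxor x ei)
  have hπ : (fun j => (bxor x ei) (i.succAbove j)) = fun j => x (i.succAbove j) := by
    funext j
    change (x (i.succAbove j) ^^ decide (i.succAbove j = i)) = x (i.succAbove j)
    rw [decide_eq_false (Fin.succAbove_ne i j), Bool.xor_false]
  have hxi : signOf ((bxor x ei) i) = -signOf (x i) := by
    change signOf (x i ^^ decide (i = i)) = -signOf (x i)
    rw [decide_eq_true rfl, Bool.xor_true]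
    cases x i <;> simp [signOf]
  rw [hπ, hxi, hu', hexact] at hs2
  rw [hu'] at hs1
  rw [hw₀] at hs1 hs2
  have hsum : (2 : ℝ) ^ 5 * (u' x : ℝ) + (2 : ℝ) ^ 5 * (((2 * sZ (f (bxor x ei)) : ℤ)) : ℝ) =
      2 * ((2 : ℝ) ^ 4 * (w₀ (fun j => x (i.succAbove j)) : ℝ)) := by rw [hs1, hs2]; ring
  have h' : ((u' x : ℤ) : ℝ) = ((w₀ (fun j => x (i.succAbove j)) - 2 * sZ (f (bxor x ei)) : ℤ) : ℝ) := by
    push_cast at hsum ⊢; linarith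
  exact_mod_cast h'

/-- Congruence bookkeeping: for odd `w`, `4 ∣ w − (−1)^{[⌊w/2⌋ odd]}`. [folklore] -/
theorem tw59_four_dvd_sub_sZ_digit (w : ℤ) (hw : Odd w) : (4 : ℤ) ∣ w - sZ (decide (Odd (w / 2))) := by
  have h1 : w % 2 = 1 := Int.odd_iff.1 hw
  by_cases h : Odd (w / 2)
  · have h2 : w / 2 % 2 = 1 := Int.odd_iff.1 h
    have hs : sZ (decide (Odd (w / 2))) = -1 := by rw [decide_eq_true h]; rfl
    rw [hs]
    omega
  · have h2 : w / 2 % 2 = 0 := Int.even_iff.1 (Int.not_odd_iff_even.1 h)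
    have hs : sZ (decide (Odd (w / 2))) = 1 := by rw [decide_eq_false h]; rfl
    rw [hs]
    omega

/-- **The residual's sign on the odd hyperplane is a quadratic's sign.**  In the setting of `tw59_half_spectrum` there is a Boolean
`D̄` of degree `≤ 2` on `𝔽₂¹²` (namely `[⌊w₀/2⌋ odd] ∘ π_i`, quadratic by the 11-bit digit lemma `el_digitOne`) with
`u'(x) − 2(−1)^{f(x)} ≡ (−1)^{D̄(x)} (mod 4)` at every point of the odd set. [this work] -/
theorem tw59_quadratic_digit (f g : (Fin (6 + 6) → Bool) → Bool) (hg : IsDegLeFun 3 g) (u' : (Fin (6 + 6) → Bool) → ℤ)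
    (hu' : ∀ x, W (fun y => signOf (g y)) x = (2 : ℝ) ^ 5 * (u' x : ℝ))
    (γ : Fin (6 + 6) → Bool) (tg : ℝ) (hPg : ∀ x, (Odd (u' x) ↔ twist γ x = tg)) (i : Fin (6 + 6)) (hγi : γ i = true)
    (hoff : ∀ y, ¬ Odd (u' y) → u' y = 2 * sZ (f y)) :
    ∃ D : (Fin (6 + 6) → Bool) → Bool, IsDegLeFun 2 D ∧ ∀ x, Odd (u' x) → (4 : ℤ) ∣ u' x - 2 * sZ (f x) - sZ (D x) := by
  have hg₀ := tw59_restrict_isDegLeFun g hg i false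
  obtain ⟨w₀, hw₀⟩ := el_base _ hg₀
  refine ⟨fun x => decide (Odd (w₀ (fun j => x (i.succAbove j)) / 2)), ?_, ?_⟩
  · exact fc_isDegLeFun_comp (D := 1) (el_digitOne _ w₀ hg₀ hw₀) (fun x : Fin (6 + 6) → Bool => fun j => x (i.succAbove j))
      (fun j => isDegLeFun_apply _ le_rfl) (by norm_num)
  · intro x hx
    have hkey := tw59_half_spectrum f g u' hu' γ tg hPg i hγi hoff w₀ hw₀ x hx
    have hwodd : Odd (w₀ (fun j => x (i.succAbove j))) := by
      have : w₀ (fun j => x (i.succAbove j)) = u' x + 2 * sZ (f (bxor x (fun j => decide (j = i)))) := by rw [hkey]; ring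
      rw [this]
      exact Int.odd_add.2 (iff_of_true hx ⟨_, two_mul _⟩)
    have h4 := tw59_four_dvd_sub_sZ_digit _ hwodd
    have hs : ∀ b : Bool, sZ b = 1 ∨ sZ b = -1 := fun b => by cases b <;> simp [sZ]
    dsimp only
    rw [hkey]
    rcases hs (f (bxor x fun j => decide (j = i))) with h1 | h1 <;> rcases hs (f x) with h2 | h2 <;>
      rw [h1, h2] <;> omega

end Summit.QuantumAdvantage.QuantumAdvantage.Theorems.CubicForrelation.NearExactIsExact

end
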